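import Summits.QuantumFields.YangMills.Theorems.BalabanUVNodesN21ShellSplitSelected13CoPHDefs
import Summits.QuantumFields.YangMills.Theorems.BalabanUVNodesN21ShellSplitOfRecord13CoPHDefsCmap

/-!
# N21 THRESHOLD SHELLS ∕ design (ii) «the selected band» — χ-GENERIC («Cmap» ∕ Chi EDITION): `bandSumA∕B₁₃Chi`, `massA∕B₁₃Chi`, `bandBadness₁₃Chi`, `selDepth₁₃Chi`,
# `bandA∕B₁₃Chi`, the letter TYPE `DepthLetter₁₃CoPHCmap N Χ`, the reading `shellSplitSelected₁₃AtCmap Χ K₀ ρ n : ShellSplit₁₃CoPHCmap N Χ K₀` — §7 of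
# `Thm/BalabanUVNodesN21ShellSplitSelected13CoPHDefs` (dag-n21-d) RE-ISSUED over the β-slot (plan g99 census row 8), receipts at `χ := chiβOfRecord₁₃ θ` (`rfl`), RE-CENTRED `…Ax`

Cell `pub-ymgap`, YM-PLAN Track A (HUMAN RULING D-0062); seat `pub-ymgap-dag-n15-a` (g38) — op 5c (a) T4 of HANDS-4 (dag-lead g40 WORDS 591; g41 WORDS 610 (4) T4 REBALANCE:
dag-n15-c silent ⇒ n15-a files the three T4 basenames), supply for K3ᴬ `SpineGivenEndpointR13SepCoPHVAx` (stmt-QuantumFields-27247; plan g99 memo `OP5C-SUPPLY-CENSUS-K3v8.md`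
§2 rows 6–8 ∕ §3 ∕ σ4–σ5; node00-def-RR-2 GATE-0 Q-TRANSPORT = NO, I.21769).  `--kind definition --supports stmt-QuantumFields-27247 --as helper`; COUNT-NEUTRAL.  NOTHING of record
is edited (body-freeze; NEW basename beside the untouched parent): every declaration below is the VERBATIM body of the like-named parent declaration with exactly the substitutions
of T3 `…SpineReadingOfRecord13CoPHChi` (dag-n20-d ✓p806069): `(hP : θ.Provisos₁₃CoPH F N) ↦ (χ : ChiSlot F N) (hP : θ.Provisos₁₃CoPHChi F N χ)`, `histA∕B₁₃ θ ↦ histA∕B₁₃Chi θ χ`,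
`keyA∕B₁₃ θ ↦ keyA∕B₁₃Chi θ χ`, `classSet₁₃ ∕ badClass₁₃ θ ↦ …Chi θ χ`, `datumOfRecord₁₃CoPH θ hP ↦ datumOfRecord₁₃CoPHChi θ χ hP`; names `X₁₃ ↦ X₁₃Chi` (θ-level, slot `χ`) ∕
`XCmap` (family-level, slot READING `Χ : (F : T4Family) → Stage13Params F N → ChiSlot F N`, read at `Χ F θ.toStage13Params`; letter TYPES `…Letter₁₃CoPHCmap N Χ`, readings
`ShellSplit₁₃CoPHCmap N Χ K₀` ∕ `SpineReading₁₃CoPHCmap N Χ` ∕ `crOfRecord₁₃AtCmap Χ …` from T2∕T3 BY NAME, not re-declared); receipts at the record's own slot `χ := chiβOfRecord₁₃ θ` (`rfl`,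
provisos transported through `provisos₁₃CoPHChi_chiβ_iff`); RE-CENTRED instances `abbrev XAx := X… (chiβOfRecord₁₃Ax …)`.

WHAT IS DEFINED ∕ PROVED (definitions + `rfl` ∕ `choose_spec` bookkeeping; zero `sorry`).  §7χ the θ-level band objects at the χ-datum ∕ χ-histories ∕ χ-keys (`bandSumA∕B₁₃Chi`,
`massA∕B₁₃Chi`, `bandBadness₁₃Chi`, `selDepth₁₃Chi` + `_spec ∕ _le`, `bandA∕B₁₃Chi`) · the TYPE `DepthLetter₁₃CoPHCmap N Χ` · `shellSplitSelected₁₃AtCmap Χ K₀ ρ n` (+ `_fst ∕ _snd`,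
`crOfRecord₁₃AtCmap_shellSplitSelected_shA ∕ _shB`, `rfl`) · §R receipts `bandA∕B₁₃Chi_chiβ`, `selDepth₁₃Chi_chiβ`, `shellSplitSelected₁₃AtCmap_chiβ` · §A `DepthLetter₁₃CoPHAx`, `bandA∕B₁₃Ax`,
`selDepth₁₃Ax`, `shellSplitSelected₁₃AtAx`.  The parent's §6 (`cutGrid`, `bandWeightOfDatum₉`) is DATUM-GENERIC (χ-free) and USED BY NAME.

HONEST FRAMING.  DEFINITIONS re-issued over a parameter + `rfl` bookkeeping; NO estimate; nothing of Bałaban's asserted, ported or discharged; no `Provisos₁₃CoPHChi ∕ …Ax`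
inhabitant claimed (K0 open); K-Ax cruxes 3∕3 OPEN; N21 ∕ N19 ∕ N27 NOT discharged; N15's record untouched; counts UNMOVED (typed 28∕28 · discharged 8∕27); one finite four-torus
programme at fixed `ε` — NOT ℝ⁴, NOT OS, NOT a mass gap, NOT the Clay problem.  No `instance`, no `notation`, no `sorry`, no `axiom`; no decl below carries a cite tag.
-/

noncomputable section

open scoped BigOperators
open Finset MeasureTheory

namespace Summit.QuantumFields.YangMills.Theorems.N21ShellSplitOfRecord13CoPH

open Literature.MathematicalPhysics.QuantumFieldTheory.Balaban1983to89
open Literature.MathematicalPhysics.QuantumFieldTheory.Balaban1983to89.T4Continuum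
open Literature.MathematicalPhysics.QuantumFieldTheory.Balaban1983to89.Node00
open YMDAG.UVSplit (crOfRecord₁₃At ShellSplit₁₃CoPH keyA₁₃ keyB₁₃ runA₁₃ runB₁₃ histA₁₃ histB₁₃
  crOfRecord₁₃AtCmap ShellSplit₁₃CoPHCmap ShellSplit₁₃CoPHAx keyA₁₃Chi keyB₁₃Chi histA₁₃Chi histB₁₃Chi)

/-! ## §7χ The keyed SELECTED shell split at the χ-keyed Stage-13 record -/

section KeyedSel

variable {F : T4Family} {N : ℕ} [NeZero N]
  {Χ : (F : T4Family) → Stage13Params F N → ChiSlot F N}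

/-- **RUN A's TOTAL BAND MASS AT DEPTH `i`** (comparison `K`, level `K₀ + K`, width `ρ K`, source `t`): `Σ_s band_s(θ_i, θ_{i+1})` over the run's (2.18) histories.
[bookkeeping] -/
def bandSumA₁₃Chi (θ : Stage13HParams F N) (χ : ChiSlot F N) (hP : θ.Provisos₁₃CoPHChi F N χ) (K₀ : ℕ) (g₀ : ℕ → ℝ) (os : List (ULoop F)) (ρ : ℕ → ℝ) (K i : ℕ) (t : ℝ) : ℝ :=
  ∑ s : SeqOfRecord F θ.ν θ.τ9.M (histA₁₃Chi θ χ K₀ g₀ K) (K₀ + K) (K₀ + K),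
    bandWeightOfDatum₉ F N θ.toStage9Params (datumOfRecord₁₃CoPHChi F N θ χ hP) g₀ os (runA₁₃ F K₀ g₀ K) (histA₁₃Chi θ χ K₀ g₀ K) (K₀ + K)
      (cutGrid θ.ν (histA₁₃Chi θ χ K₀ g₀ K) (K₀ + K) (ρ K) i) (cutGrid θ.ν (histA₁₃Chi θ χ K₀ g₀ K) (K₀ + K) (ρ K) (i + 1)) t s

/-- **RUN B's TOTAL BAND MASS AT DEPTH `i`** (comparison `K`, level `K₀ + K + 1`). [bookkeeping] -/
def bandSumB₁₃Chi (θ : Stage13HParams F N) (χ : ChiSlot F N) (hP : θ.Provisos₁₃CoPHChi F N χ) (K₀ : ℕ) (g₀ : ℕ → ℝ) (os : List (ULoop F)) (ρ : ℕ → ℝ) (K i : ℕ) (t : ℝ) : ℝ :=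
  ∑ s' : SeqOfRecord F θ.ν θ.τ9.M (histB₁₃Chi θ χ K₀ g₀ K) (K₀ + K + 1) (K₀ + K + 1),
    bandWeightOfDatum₉ F N θ.toStage9Params (datumOfRecord₁₃CoPHChi F N θ χ hP) g₀ os (runB₁₃ F K₀ g₀ K) (histB₁₃Chi θ χ K₀ g₀ K) (K₀ + K + 1)
      (cutGrid θ.ν (histB₁₃Chi θ χ K₀ g₀ K) (K₀ + K + 1) (ρ K) i) (cutGrid θ.ν (histB₁₃Chi θ χ K₀ g₀ K) (K₀ + K + 1) (ρ K) (i + 1)) t s'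

/-- **RUN A's DRESSED PARTITION SUM** `Σ_s classWeightOfDatum₉ …` at comparison `K`, source `t` (= `Σ_{x ∈ classSet₁₃Chi} weightA₁₃ … K t x`, companion). [bookkeeping] -/
def massA₁₃Chi (θ : Stage13HParams F N) (χ : ChiSlot F N) (hP : θ.Provisos₁₃CoPHChi F N χ) (K₀ : ℕ) (g₀ : ℕ → ℝ) (os : List (ULoop F)) (K : ℕ) (t : ℝ) : ℝ :=
  ∑ s : SeqOfRecord F θ.ν θ.τ9.M (histA₁₃Chi θ χ K₀ g₀ K) (K₀ + K) (K₀ + K),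
    classWeightOfDatum₉ F N θ.toStage9Params (datumOfRecord₁₃CoPHChi F N θ χ hP) g₀ os (runA₁₃ F K₀ g₀ K) (histA₁₃Chi θ χ K₀ g₀ K) (K₀ + K) t s

/-- **RUN B's DRESSED PARTITION SUM** at comparison `K`, source `t`. [bookkeeping] -/
def massB₁₃Chi (θ : Stage13HParams F N) (χ : ChiSlot F N) (hP : θ.Provisos₁₃CoPHChi F N χ) (K₀ : ℕ) (g₀ : ℕ → ℝ) (os : List (ULoop F)) (K : ℕ) (t : ℝ) : ℝ :=
  ∑ s' : SeqOfRecord F θ.ν θ.τ9.M (histB₁₃Chi θ χ K₀ g₀ K) (K₀ + K + 1) (K₀ + K + 1),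
    classWeightOfDatum₉ F N θ.toStage9Params (datumOfRecord₁₃CoPHChi F N θ χ hP) g₀ os (runB₁₃ F K₀ g₀ K) (histB₁₃Chi θ χ K₀ g₀ K) (K₀ + K + 1) t s'

/-- **THE BADNESS OF A DEPTH**: the two runs' band masses at depth `i`, each normalised by its run's dressed partition sum (`x ∕ 0 = 0`: a weightless run contributes
nothing). [bookkeeping] -/
def bandBadness₁₃Chi (θ : Stage13HParams F N) (χ : ChiSlot F N) (hP : θ.Provisos₁₃CoPHChi F N χ) (K₀ : ℕ) (g₀ : ℕ → ℝ) (os : List (ULoop F)) (ρ : ℕ → ℝ) (K : ℕ) (t : ℝ) (i : ℕ) : ℝ :=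
  bandSumA₁₃Chi θ χ hP K₀ g₀ os ρ K i t / massA₁₃Chi θ χ hP K₀ g₀ os K t + bandSumB₁₃Chi θ χ hP K₀ g₀ os ρ K i t / massB₁₃Chi θ χ hP K₀ g₀ os K t

/-- ★ **THE SELECTED DEPTH** `i⋆(K, t) ≤ n`: an ARGMIN of the badness over the depths `0, …, n` (`Finset.exists_min_image` on `range (n + 1)`, a choice). [bookkeeping] -/
def selDepth₁₃Chi (θ : Stage13HParams F N) (χ : ChiSlot F N) (hP : θ.Provisos₁₃CoPHChi F N χ) (K₀ : ℕ) (g₀ : ℕ → ℝ) (os : List (ULoop F)) (ρ : ℕ → ℝ) (n K : ℕ) (t : ℝ) : ℕ :=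
  Classical.choose ((Finset.range (n + 1)).exists_min_image (bandBadness₁₃Chi θ χ hP K₀ g₀ os ρ K t) ⟨0, Finset.mem_range.2 (Nat.succ_pos n)⟩)

/-- Spec of the selected depth: it is one of `0, …, n` and its badness is minimal there. [bookkeeping] -/
theorem selDepth₁₃Chi_spec (θ : Stage13HParams F N) (χ : ChiSlot F N) (hP : θ.Provisos₁₃CoPHChi F N χ) (K₀ : ℕ) (g₀ : ℕ → ℝ) (os : List (ULoop F)) (ρ : ℕ → ℝ) (n K : ℕ) (t : ℝ) :
    selDepth₁₃Chi θ χ hP K₀ g₀ os ρ n K t ∈ Finset.range (n + 1) ∧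
      ∀ j ∈ Finset.range (n + 1), bandBadness₁₃Chi θ χ hP K₀ g₀ os ρ K t (selDepth₁₃Chi θ χ hP K₀ g₀ os ρ n K t) ≤ bandBadness₁₃Chi θ χ hP K₀ g₀ os ρ K t j :=
  Classical.choose_spec ((Finset.range (n + 1)).exists_min_image (bandBadness₁₃Chi θ χ hP K₀ g₀ os ρ K t) ⟨0, Finset.mem_range.2 (Nat.succ_pos n)⟩)

/-- The selected depth is at most `n`. [bookkeeping] -/
theorem selDepth₁₃Chi_le (θ : Stage13HParams F N) (χ : ChiSlot F N) (hP : θ.Provisos₁₃CoPHChi F N χ) (K₀ : ℕ) (g₀ : ℕ → ℝ) (os : List (ULoop F)) (ρ : ℕ → ℝ) (n K : ℕ) (t : ℝ) :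
    selDepth₁₃Chi θ χ hP K₀ g₀ os ρ n K t ≤ n :=
  Nat.lt_succ_iff.1 (Finset.mem_range.1 (selDepth₁₃Chi_spec θ χ hP K₀ g₀ os ρ n K t).1)

/-- **RUN A's KEYED BAND AT THE SELECTED DEPTH** (comparison `K`, source `t`, depth letters `n`): the fibre sum along n20-d's key of record `keyA₁₃Chi` of the term bands
between `θ_{i⋆}` and `θ_{i⋆+1}`, `i⋆ = selDepth₁₃Chi … ρ (n K) K t`. [bookkeeping] -/
def bandA₁₃Chi (θ : Stage13HParams F N) (χ : ChiSlot F N) (hP : θ.Provisos₁₃CoPHChi F N χ) (K₀ : ℕ) (g₀ : ℕ → ℝ) (os : List (ULoop F)) (ρ : ℕ → ℝ) (n : ℕ → ℕ)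
    (K : ℕ) (t : ℝ) (x : Σ K, SiteSeqKey F (K₀ + K)) : ℝ :=
  letI : ∀ Kc, DecidableEq (SiteSeqKey F Kc) := fun _ => Classical.decEq _
  ∑ s ∈ univ.filter (fun s => keyA₁₃Chi θ χ K₀ g₀ K s = x),
    bandWeightOfDatum₉ F N θ.toStage9Params (datumOfRecord₁₃CoPHChi F N θ χ hP) g₀ os (runA₁₃ F K₀ g₀ K) (histA₁₃Chi θ χ K₀ g₀ K) (K₀ + K)
      (cutGrid θ.ν (histA₁₃Chi θ χ K₀ g₀ K) (K₀ + K) (ρ K) (selDepth₁₃Chi θ χ hP K₀ g₀ os ρ (n K) K t))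
      (cutGrid θ.ν (histA₁₃Chi θ χ K₀ g₀ K) (K₀ + K) (ρ K) (selDepth₁₃Chi θ χ hP K₀ g₀ os ρ (n K) K t + 1)) t s

/-- **RUN B's KEYED BAND AT THE SELECTED DEPTH** (level `K₀ + K + 1`, along `keyB₁₃Chi`; the SAME depth `i⋆(K, t)` as run A). [bookkeeping] -/
def bandB₁₃Chi (θ : Stage13HParams F N) (χ : ChiSlot F N) (hP : θ.Provisos₁₃CoPHChi F N χ) (K₀ : ℕ) (g₀ : ℕ → ℝ) (os : List (ULoop F)) (ρ : ℕ → ℝ) (n : ℕ → ℕ)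
    (K : ℕ) (t : ℝ) (x : Σ K, SiteSeqKey F (K₀ + K)) : ℝ :=
  letI : ∀ Kc, DecidableEq (SiteSeqKey F Kc) := fun _ => Classical.decEq _
  ∑ s' ∈ univ.filter (fun s' => keyB₁₃Chi θ χ K₀ g₀ K s' = x),
    bandWeightOfDatum₉ F N θ.toStage9Params (datumOfRecord₁₃CoPHChi F N θ χ hP) g₀ os (runB₁₃ F K₀ g₀ K) (histB₁₃Chi θ χ K₀ g₀ K) (K₀ + K + 1)
      (cutGrid θ.ν (histB₁₃Chi θ χ K₀ g₀ K) (K₀ + K + 1) (ρ K) (selDepth₁₃Chi θ χ hP K₀ g₀ os ρ (n K) K t))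
      (cutGrid θ.ν (histB₁₃Chi θ χ K₀ g₀ K) (K₀ + K + 1) (ρ K) (selDepth₁₃Chi θ χ hP K₀ g₀ os ρ (n K) K t + 1)) t s'

variable (N) in
/-- **DEPTH LETTERS**: a grid depth per tuple and comparison index (the consumer's choice; `Σ_K 1∕(n_K + 1) < ∞` makes the selected band's weight summable). [bookkeeping] -/
abbrev DepthLetter₁₃CoPHCmap (Χ : (F : T4Family) → Stage13Params F N → ChiSlot F N) : Type 1 :=
  (F : T4Family) → (θ : Stage13HParams F N) → θ.Provisos₁₃CoPHChi F N (Χ F θ.toStage13Params) → (ℕ → ℝ) → List (ULoop F) → ℕ → ℕ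

variable (Χ) in
/-- ★ **THE SELECTED SHELL SPLIT AT OFFSET `K₀`** with ONE width letter `ρ` (common to both runs) and a depth letter `n`: the pair `(bandA₁₃Chi, bandB₁₃Chi)` at every tuple —
an inhabitant of n20-d's `ShellSplit₁₃CoPHCmap N Χ K₀` whose `ShellWeightBound` the companion proves WITHOUT anti-concentration. [bookkeeping] -/
def shellSplitSelected₁₃AtCmap (K₀ : ℕ) (ρ : WidthLetter₁₃CoPHCmap N Χ) (n : DepthLetter₁₃CoPHCmap N Χ) : ShellSplit₁₃CoPHCmap N Χ K₀ := fun F θ hP g₀ os =>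
  (bandA₁₃Chi θ (Χ F θ.toStage13Params) hP K₀ g₀ os (ρ F θ hP g₀ os) (n F θ hP g₀ os), bandB₁₃Chi θ (Χ F θ.toStage13Params) hP K₀ g₀ os (ρ F θ hP g₀ os) (n F θ hP g₀ os))

/-- Dictionary: the split's first component is `bandA₁₃Chi`. [bookkeeping] -/
@[simp] theorem shellSplitSelected₁₃AtCmap_fst (K₀ : ℕ) (ρ : WidthLetter₁₃CoPHCmap N Χ) (n : DepthLetter₁₃CoPHCmap N Χ) (F : T4Family) (θ : Stage13HParams F N)
    (hP : θ.Provisos₁₃CoPHChi F N (Χ F θ.toStage13Params)) (g₀ : ℕ → ℝ) (os : List (ULoop F)) :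
    (shellSplitSelected₁₃AtCmap Χ K₀ ρ n F θ hP g₀ os).1 = bandA₁₃Chi θ (Χ F θ.toStage13Params) hP K₀ g₀ os (ρ F θ hP g₀ os) (n F θ hP g₀ os) := rfl

/-- Dictionary: the split's second component is `bandB₁₃Chi`. [bookkeeping] -/
@[simp] theorem shellSplitSelected₁₃AtCmap_snd (K₀ : ℕ) (ρ : WidthLetter₁₃CoPHCmap N Χ) (n : DepthLetter₁₃CoPHCmap N Χ) (F : T4Family) (θ : Stage13HParams F N)
    (hP : θ.Provisos₁₃CoPHChi F N (Χ F θ.toStage13Params)) (g₀ : ℕ → ℝ) (os : List (ULoop F)) :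
    (shellSplitSelected₁₃AtCmap Χ K₀ ρ n F θ hP g₀ os).2 = bandB₁₃Chi θ (Χ F θ.toStage13Params) hP K₀ g₀ os (ρ F θ hP g₀ os) (n F θ hP g₀ os) := rfl

/-- ★ Dictionary: the `shA` of the spine reading of record at the selected split is run A's keyed band at the selected depth (`rfl`). [bookkeeping] -/
theorem crOfRecord₁₃AtCmap_shellSplitSelected_shA (K₀ : ℕ) (jcut : ℕ → ℕ) (ρ : WidthLetter₁₃CoPHCmap N Χ) (n : DepthLetter₁₃CoPHCmap N Χ) (F : T4Family)
    (θ : Stage13HParams F N) (hP : θ.Provisos₁₃CoPHChi F N (Χ F θ.toStage13Params)) (g₀ : ℕ → ℝ) (os : List (ULoop F)) :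
    (crOfRecord₁₃AtCmap Χ K₀ jcut (shellSplitSelected₁₃AtCmap Χ K₀ ρ n) F θ hP g₀ os).shA = bandA₁₃Chi θ (Χ F θ.toStage13Params) hP K₀ g₀ os (ρ F θ hP g₀ os) (n F θ hP g₀ os) := rfl

/-- ★ Dictionary: the `shB` of the spine reading of record at the selected split is run B's keyed band at the selected depth (`rfl`). [bookkeeping] -/
theorem crOfRecord₁₃AtCmap_shellSplitSelected_shB (K₀ : ℕ) (jcut : ℕ → ℕ) (ρ : WidthLetter₁₃CoPHCmap N Χ) (n : DepthLetter₁₃CoPHCmap N Χ) (F : T4Family)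
    (θ : Stage13HParams F N) (hP : θ.Provisos₁₃CoPHChi F N (Χ F θ.toStage13Params)) (g₀ : ℕ → ℝ) (os : List (ULoop F)) :
    (crOfRecord₁₃AtCmap Χ K₀ jcut (shellSplitSelected₁₃AtCmap Χ K₀ ρ n) F θ hP g₀ os).shB = bandB₁₃Chi θ (Χ F θ.toStage13Params) hP K₀ g₀ os (ρ F θ hP g₀ os) (n F θ hP g₀ os) := rfl

end KeyedSel

/-! ## §R Receipts at the record's own β-slot `χ := chiβOfRecord₁₃ θ` (definitional) -/

section Receipts

variable {F : T4Family} {N : ℕ} [NeZero N] (θ : Stage13HParams F N) (hP : θ.Provisos₁₃CoPHChi F N (chiβOfRecord₁₃ F N θ.toStage13Params)) (K₀ : ℕ) (g₀ : ℕ → ℝ)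
  (os : List (ULoop F)) (ρ : ℕ → ℝ)

/-- Receipt: the χ-selected depth at the record's β-slot IS `selDepth₁₃`. [bookkeeping] -/
theorem selDepth₁₃Chi_chiβ (n K : ℕ) (t : ℝ) :
    selDepth₁₃Chi θ (chiβOfRecord₁₃ F N θ.toStage13Params) hP K₀ g₀ os ρ n K t = selDepth₁₃ θ ((provisos₁₃CoPHChi_chiβ_iff θ).1 hP) K₀ g₀ os ρ n K t := rfl

/-- Receipt: run A's χ-keyed band at the record's β-slot IS `bandA₁₃`. [bookkeeping] -/
theorem bandA₁₃Chi_chiβ (n : ℕ → ℕ) : bandA₁₃Chi θ (chiβOfRecord₁₃ F N θ.toStage13Params) hP K₀ g₀ os ρ n = bandA₁₃ θ ((provisos₁₃CoPHChi_chiβ_iff θ).1 hP) K₀ g₀ os ρ n := rfl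

/-- Receipt: run B's χ-keyed band at the record's β-slot IS `bandB₁₃`. [bookkeeping] -/
theorem bandB₁₃Chi_chiβ (n : ℕ → ℕ) : bandB₁₃Chi θ (chiβOfRecord₁₃ F N θ.toStage13Params) hP K₀ g₀ os ρ n = bandB₁₃ θ ((provisos₁₃CoPHChi_chiβ_iff θ).1 hP) K₀ g₀ os ρ n := rfl

/-- Receipt: the χ-selected split at `Χ := chiβOfRecord₁₃` IS `shellSplitSelected₁₃At` at the transported provisos and the letters read back through them. [bookkeeping] -/
theorem shellSplitSelected₁₃AtCmap_chiβ (ρ₁ : WidthLetter₁₃CoPH N) (n : DepthLetter₁₃CoPH N) :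
    shellSplitSelected₁₃AtCmap (fun F => chiβOfRecord₁₃ F N) K₀ (fun F θ h g₀ os => ρ₁ F θ ((provisos₁₃CoPHChi_chiβ_iff θ).1 h) g₀ os)
        (fun F θ h g₀ os => n F θ ((provisos₁₃CoPHChi_chiβ_iff θ).1 h) g₀ os) F θ hP g₀ os =
      shellSplitSelected₁₃At N K₀ ρ₁ n F θ ((provisos₁₃CoPHChi_chiβ_iff θ).1 hP) g₀ os := rfl

end Receipts

/-! ## §A The RE-CENTRED instances (`χ := chiβOfRecord₁₃Ax θ`) -/

section Ax

variable {F : T4Family} {N : ℕ} [NeZero N]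

/-- The selected depth of record, RE-CENTRED. [bookkeeping] -/
abbrev selDepth₁₃Ax (θ : Stage13HParams F N) (hP : θ.Provisos₁₃CoPHAx F N) (K₀ : ℕ) (g₀ : ℕ → ℝ) (os : List (ULoop F)) (ρ : ℕ → ℝ) (n K : ℕ) (t : ℝ) : ℕ :=
  selDepth₁₃Chi θ (chiβOfRecord₁₃Ax F N θ.toStage13Params) hP K₀ g₀ os ρ n K t

/-- Run A's keyed band at the selected depth, RE-CENTRED. [bookkeeping] -/
abbrev bandA₁₃Ax (θ : Stage13HParams F N) (hP : θ.Provisos₁₃CoPHAx F N) (K₀ : ℕ) (g₀ : ℕ → ℝ) (os : List (ULoop F)) (ρ : ℕ → ℝ) (n : ℕ → ℕ)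
    (K : ℕ) (t : ℝ) (x : Σ K, SiteSeqKey F (K₀ + K)) : ℝ :=
  bandA₁₃Chi θ (chiβOfRecord₁₃Ax F N θ.toStage13Params) hP K₀ g₀ os ρ n K t x

/-- Run B's keyed band at the selected depth, RE-CENTRED. [bookkeeping] -/
abbrev bandB₁₃Ax (θ : Stage13HParams F N) (hP : θ.Provisos₁₃CoPHAx F N) (K₀ : ℕ) (g₀ : ℕ → ℝ) (os : List (ULoop F)) (ρ : ℕ → ℝ) (n : ℕ → ℕ)
    (K : ℕ) (t : ℝ) (x : Σ K, SiteSeqKey F (K₀ + K)) : ℝ :=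
  bandB₁₃Chi θ (chiβOfRecord₁₃Ax F N θ.toStage13Params) hP K₀ g₀ os ρ n K t x

variable (N) in
/-- The depth-letter TYPE, RE-CENTRED (the K3ᴬ v8 `DialRows (n₁ n₂ : …)` binder). [bookkeeping] -/
abbrev DepthLetter₁₃CoPHAx : Type 1 := DepthLetter₁₃CoPHCmap N (fun F => chiβOfRecord₁₃Ax F N)

/-- The keyed selected shell split at offset `K₀`, RE-CENTRED. [bookkeeping] -/
abbrev shellSplitSelected₁₃AtAx (K₀ : ℕ) (ρ : WidthLetter₁₃CoPHAx N) (n : DepthLetter₁₃CoPHAx N) : ShellSplit₁₃CoPHAx N K₀ :=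
  shellSplitSelected₁₃AtCmap (fun F => chiβOfRecord₁₃Ax F N) K₀ ρ n

end Ax

end Summit.QuantumFields.YangMills.Theorems.N21ShellSplitOfRecord13CoPH

end
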